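import Summits.ValiantsHypothesis.ValiantsHypothesis.Theses.SymPencil
import Literature.Computability.AlgebraicComplexity.SymmetricDetRepresentationProofs

/-!
# Route SymPencil — item `SdcOfDc` (stmt-ValiantsHypothesis-5680): `sdc(f) ≤ 4·dc(f)³ + 7`

The known transfer from ordinary to SYMMETRIC affine determinantal representations
(Grenet–Kaltofen–Koiran–Portier 2011, Thm. 5, communicated by Mahajan–Nimbhorkar; arXiv:1007.3804
§3.2): the generic determinant `DET_m` is `det M` for a symmetric matrix `M` of dimension
`4m³ + 7` whose entries are variables `x_{ij}` or constants `0, 1, -1, 1/2`.  That statement is the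
tree's named fact `Literature.Computability.AlgebraicComplexity.GKKP2011_detPoly_symmetric`,
DISCHARGED in the tree by
`Literature.Computability.AlgebraicComplexity.GKKP2011_detPoly_symmetric_holds`
(`SymmetricDetRepresentationProofs.lean`), so everything below is unconditional.

Given an affine determinantal representation `f = det A`, `A` of size `m` over
`MvPolynomial N ℂ`, substitute the (affine) entries of `A` for the variables `x_{ij}` of `M`
(`MvPolynomial.aeval fun p => A p.1 p.2`, applied entrywise): the result is symmetric
(`Matrix.IsSymm.map`), its entries are entries of `A` or constants (total degree `≤ 1`), and its
determinant is `aeval (det (x_{ij})) = det A = f` (`AlgHom.map_det`,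
`Matrix.mvPolynomialX_mapMatrix_aeval`).  No finiteness of the variable type `N` is needed.

Main results:
* `hasSymmAffineDetRepr_of_isAffineDetRepr` — the substitution, for one representation `A`;
* `SdcOfDc_proof : …Theses.SymPencil.SdcOfDc` — closes the item (size `m' = 4m³ + 7` itself).
-/

noncomputable section

-- single-conjunct layout: Sub = Summit, duplicated namespace component intended
set_option linter.dupNamespace false

namespace Summit.ValiantsHypothesis.ValiantsHypothesis.Theorems.SymPencil

open MvPolynomial Literature.Computability.AlgebraicComplexity

/-- **Substitution into GKKP Thm. 5.** If `f = det A` for an `m × m` matrix `A` of affine linear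
forms over `ℂ` (in any set of variables `N`), then `f = det B` for a SYMMETRIC matrix `B` of
affine linear forms of size exactly `4m³ + 7`: take the symmetric matrix `M` of
Grenet–Kaltofen–Koiran–Portier 2011, Thm. 5 (`DET_m = det M`, entries `x_{ij}, 0, ±1, 1/2`) and
substitute `A i j` for `x_{ij}`. [cite: GrenetEtAl2011, Thm 5] -/
theorem hasSymmAffineDetRepr_of_isAffineDetRepr {N : Type*} {f : MvPolynomial N ℂ} {m : ℕ}
    {A : Matrix (Fin m) (Fin m) (MvPolynomial N ℂ)} (hA : IsAffineDetRepr f A) :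
    ∃ B : Matrix (Fin (4 * m ^ 3 + 7)) (Fin (4 * m ^ 3 + 7)) (MvPolynomial N ℂ),
      B.IsSymm ∧ IsAffineDetRepr f B := by
  obtain ⟨hAdeg, hAdet⟩ := hA
  obtain ⟨M, hMsymm, hMentry, hMdet⟩ :=
    GKKP2011_detPoly_symmetric_holds ℂ two_ne_zero m
  -- the substitution `x_{ij} ↦ A i j`
  let φ : MvPolynomial (Fin m × Fin m) ℂ →ₐ[ℂ] MvPolynomial N ℂ := aeval fun p => A p.1 p.2
  refine ⟨M.map φ, hMsymm.map φ, ?_, ?_⟩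
  · -- entries stay affine: variables go to entries of `A`, constants to constants
    intro a b
    rw [Matrix.map_apply]
    rcases hMentry a b with ⟨ij, hij⟩ | h0 | h1 | hm1 | hC
    · rw [hij]
      simpa only [φ, aeval_X] using hAdeg ij.1 ij.2
    · rw [h0, map_zero, totalDegree_zero]
      exact Nat.zero_le _
    · rw [h1, map_one, totalDegree_one]
      exact Nat.zero_le _
    · rw [hm1, map_neg, map_one, totalDegree_neg, totalDegree_one]
      exact Nat.zero_le _
    · rw [hC]
      simp only [φ, aeval_C, algebraMap_eq, totalDegree_C]
      exact Nat.zero_le _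
  · -- determinant: `det (M.map φ) = φ (det M) = φ (DET_m) = det A = f`
    have hmap : (M.map φ).det = φ M.det := (AlgHom.map_det φ M).symm
    rw [hmap, hMdet, detPoly, AlgHom.map_det, Matrix.mvPolynomialX_mapMatrix_aeval ℂ A, hAdet]

/-- **Item `SdcOfDc` (stmt-ValiantsHypothesis-5680) holds**: every polynomial over `ℂ` with an
affine determinantal representation of size `m` has a symmetric one of size `m' ≤ 4m³ + 7`
(here `m' = 4m³ + 7` itself) — Grenet–Kaltofen–Koiran–Portier 2011, Thm. 5 (Mahajan–Nimbhorkar)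
composed with substitution of affine forms for the variables. [cite: GrenetEtAl2011, Thm 5] -/
theorem SdcOfDc_proof : Summit.ValiantsHypothesis.ValiantsHypothesis.Theses.SymPencil.SdcOfDc := by
  intro N f m h
  obtain ⟨A, hA⟩ := h
  exact ⟨4 * m ^ 3 + 7, le_rfl, hasSymmAffineDetRepr_of_isAffineDetRepr hA⟩

end Summit.ValiantsHypothesis.ValiantsHypothesis.Theorems.SymPencil

end
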